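import Literature.Geometry.Lorentzian.Basic
import Literature.MathematicalPhysics.QuantumManyBody.LiebYngvasonPoincare
import Mathlib.Analysis.Real.Pi.Bounds

/-!
# Route ClusterCompleteness — crux `AdiabaticMultiKerrILED`, line `Sketch`: perforated Hardy
# inequality, part 2: Poincaré on cubes, gluing of constants, the cubes of a hole

Helper file for the crux `stmt-FinalStateConjecture-14310`
(`Summit.FinalStateConjecture.FinalStateConjecture.Theses.ClusterCompleteness.AdiabaticMultiKerrILED`),
stub `stub_perforatedHardy`.

* `poincare_coordBox`: for `g ∈ C¹_c(ℝ³)` and a cube `(p, p + ℓ)` there is a constant `M` with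
  `∫_{(p, p+ℓ)} (g − M)² ≤ ℓ² ∫_{(p, p+ℓ)} ‖Dg‖²` (`ℝ≥0∞`-valued integrals). This is the Neumann
  gap of the cube (`isPoincare_space` of `Literature/MathematicalPhysics/QuantumManyBody`,
  constant `(ℓ/π)² · 3 ≤ ℓ²`), transported by the translation `x ↦ x + p`.
* `glue_const`: if `B` has measure at most `R` times that of `O ⊆ A ∩ B`, then
  `∫_B (φ − m)² ≤ (2 + 4R) ∫_B (φ − m')² + 4R ∫_A (φ − m)²` — chaining of local constants.
* the cubes of a hole `B(c, ρ)`: `B̄(c, ρ) ⊆ {‖y − c‖_∞ < 1.1ρ} ⊆ {‖y − c‖_∞ ≤ 1.15ρ} ⊆ B(c, 2ρ)`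
  and the cubical shell lies in the annulus `{ρ < |y − c| < 4ρ}`.

Folklore. [folklore]
-/

noncomputable section

-- the doubled `FinalStateConjecture.FinalStateConjecture` path component trips dupNamespace
set_option linter.dupNamespace false

open Literature.Geometry.Lorentzian MeasureTheory Set Filter Metric
open Literature.MathematicalPhysics.QuantumManyBody.BoseGas (box measurableSet_box)
open Literature.MathematicalPhysics.QuantumManyBody.BoseGas.Poincare (BddC1 isPoincare_space
  integrable_of_norm_le)
open scoped Topology ENNReal

namespace Summit.FinalStateConjecture.FinalStateConjecture.Cruxes.AdiabaticMultiKerrILED.Sketch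

/-! ### Poincaré on a cube -/

/-- **Poincaré inequality on a cube for a `C¹_c` function** (`ℝ≥0∞` form): for `g ∈ C¹_c(ℝ³)`,
`ℓ > 0` and a corner `p`, `∫_{(p, p+ℓ)} (g − M)² ≤ ℓ² ∫_{(p, p+ℓ)} ‖Dg‖²` for some constant `M`
(the mean of `g` over the cube). [folklore] -/
theorem poincare_coordBox :
    ∀ (g : E3 → ℝ) (p : Fin 3 → ℝ) (ℓ : ℝ), 0 < ℓ → ContDiff ℝ 1 g → HasCompactSupport g →
      ∃ M : ℝ, ∫⁻ y in {y : E3 | ∀ k, y k ∈ Ioo (p k) (p k + ℓ)}, ENNReal.ofReal ((g y - M) ^ 2) ≤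
        ENNReal.ofReal (ℓ ^ 2) *
          ∫⁻ y in {y : E3 | ∀ k, y k ∈ Ioo (p k) (p k + ℓ)}, ENNReal.ofReal (‖fderiv ℝ g y‖ ^ 2) := by
  intro g p ℓ hℓ hgC hgsupp
  -- translation of the unit-corner box `Λ_ℓ = (0, ℓ)³`
  set v : E3 := WithLp.toLp 2 p with hv
  have htrans : ∀ G : E3 → ℝ≥0∞, ∫⁻ y in {y : E3 | ∀ k, y k ∈ Ioo (p k) (p k + ℓ)}, G y =
      ∫⁻ x in box ℓ, G (x + v) := by
    intro G
    have hpre : {y : E3 | ∀ k, y k ∈ Ioo (p k) (p k + ℓ)} = (fun y : E3 => y - v) ⁻¹' box ℓ := by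
      ext y
      simp only [mem_Ioo, mem_preimage, box, mem_setOf_eq, hv, PiLp.sub_apply]
      refine forall_congr' fun k => ?_
      constructor <;> rintro ⟨h1, h2⟩ <;> constructor <;> linarith
    have hmp : MeasurePreserving (fun y : E3 => y - v) volume volume :=
      measurePreserving_sub_right volume v
    have hme : MeasurableEmbedding (fun y : E3 => y - v) :=
      (MeasurableEquiv.subRight v).measurableEmbedding
    have h := hmp.setLIntegral_comp_preimage_emb hme (fun x => G (x + v)) (box ℓ)
    simp only [sub_add_cancel] at h
    rw [hpre]
    exact h
  -- `3 (ℓ/π)² ≤ ℓ²`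
  have hpi : 3 * (ℓ / Real.pi) ^ 2 ≤ ℓ ^ 2 := by
    have hπ := Real.pi_gt_three
    have hπ0 : 0 < Real.pi := Real.pi_pos
    rw [div_pow, ← mul_div_assoc, div_le_iff₀ (by positivity)]
    calc 3 * ℓ ^ 2 = ℓ ^ 2 * 3 := by ring
      _ ≤ ℓ ^ 2 * Real.pi ^ 2 := mul_le_mul_of_nonneg_left (by nlinarith) (sq_nonneg ℓ)
  -- `‖e_k‖ = 1`
  have hsingle : ∀ k : Fin 3, ‖(EuclideanSpace.single k (1 : ℝ) : E3)‖ = 1 := fun k => by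
    rw [EuclideanSpace.norm_eq]
    simp [Finset.sum_ite_eq', apply_ite]
  -- translate to the corner `0`
  set g' : E3 → ℝ := fun x => g (x + v) with hg'
  have hg'C : ContDiff ℝ 1 g' := hgC.comp (contDiff_id.add contDiff_const)
  have hg'D : ∀ x, fderiv ℝ g' x = fderiv ℝ g (x + v) := fun x => fderiv_comp_add_right v
  have hbdd : BddC1 g' := by
    obtain ⟨C, hC⟩ := hgsupp.exists_bound_of_continuous hgC.continuous
    obtain ⟨C', hC'⟩ := (hgsupp.fderiv (𝕜 := ℝ)).exists_bound_of_continuous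
      (hgC.continuous_fderiv one_ne_zero)
    exact ⟨hg'C, ⟨C, fun x => hC _⟩, ⟨C', fun x => by rw [hg'D]; exact hC' _⟩⟩
  have hP := isPoincare_space (E := ℝ) hℓ g' hbdd
  set μ : Measure E3 := volume.restrict (box ℓ) with hμ
  set M : ℝ := (⨍ x, g' x ∂μ) with hM
  refine ⟨M, ?_⟩
  -- the sum of squared partial derivatives is at most `3 ‖Dg‖²`
  have hsum : ∀ x ∈ box ℓ, ∑ k, ‖fderiv ℝ g' x (EuclideanSpace.single k (1 : ℝ))‖ ^ 2 ≤
      3 * ‖fderiv ℝ g (x + v)‖ ^ 2 := by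
    intro x _
    rw [hg'D x]
    have h1 : ∀ k, ‖fderiv ℝ g (x + v) (EuclideanSpace.single k (1 : ℝ))‖ ^ 2 ≤
        ‖fderiv ℝ g (x + v)‖ ^ 2 := fun k => by
      refine pow_le_pow_left₀ (norm_nonneg _) ?_ 2
      calc _ ≤ ‖fderiv ℝ g (x + v)‖ * ‖(EuclideanSpace.single k (1 : ℝ) : E3)‖ :=
            ContinuousLinearMap.le_opNorm _ _
        _ = ‖fderiv ℝ g (x + v)‖ := by rw [hsingle, mul_one]
    calc _ ≤ ∑ _k : Fin 3, ‖fderiv ℝ g (x + v)‖ ^ 2 := Finset.sum_le_sum fun k _ => h1 k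
      _ = 3 * ‖fderiv ℝ g (x + v)‖ ^ 2 := by simp
  -- integrability on the box (finite measure, bounded continuous integrands)
  obtain ⟨C, hC⟩ := hbdd.2.1
  obtain ⟨C', hC'⟩ := hbdd.2.2
  have hint1 : Integrable (fun x => (g' x - M) ^ 2) μ := by
    refine integrable_of_norm_le (C := (C + |M|) ^ 2)
      ((hg'C.continuous.sub continuous_const).pow 2).aestronglyMeasurable fun x => ?_
    rw [Real.norm_eq_abs, abs_pow]
    have hle : |g' x - M| ≤ C + |M| :=
      calc |g' x - M| ≤ |g' x| + |M| := abs_sub _ _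
        _ ≤ C + |M| := add_le_add (by simpa using hC x) le_rfl
    exact pow_le_pow_left₀ (abs_nonneg _) hle 2
  have hint2 : Integrable (fun x => ‖fderiv ℝ g (x + v)‖ ^ 2) μ := by
    have hc : Continuous fun x : E3 => ‖fderiv ℝ g (x + v)‖ ^ 2 :=
      (((hgC.continuous_fderiv one_ne_zero).comp (continuous_id.add continuous_const)).norm).pow 2
    refine integrable_of_norm_le (C := C' ^ 2) hc.aestronglyMeasurable fun x => ?_
    rw [Real.norm_eq_abs, abs_pow, abs_norm]
    have := hC' x
    rw [hg'D] at this
    exact pow_le_pow_left₀ (norm_nonneg _) this 2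
  have hint3 : Integrable (fun x => 3 * ‖fderiv ℝ g (x + v)‖ ^ 2) μ := hint2.const_mul 3
  -- the real-variable inequality
  have hreal : ∫ x in box ℓ, (g' x - M) ^ 2 ≤ ℓ ^ 2 * ∫ x in box ℓ, ‖fderiv ℝ g (x + v)‖ ^ 2 := by
    have h1 : ∫ x in box ℓ, (g' x - M) ^ 2 = ∫ x, ‖g' x - ⨍ y, g' y ∂μ‖ ^ 2 ∂μ := by
      rw [hM, hμ]
      refine integral_congr_ae (ae_of_all _ fun x => ?_)
      simp only [Real.norm_eq_abs, sq_abs]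
    have hI : 0 ≤ ∫ x in box ℓ, ‖fderiv ℝ g (x + v)‖ ^ 2 := integral_nonneg fun _ => sq_nonneg _
    calc ∫ x in box ℓ, (g' x - M) ^ 2 = ∫ x, ‖g' x - ⨍ y, g' y ∂μ‖ ^ 2 ∂μ := h1
      _ ≤ (ℓ / Real.pi) ^ 2 *
            ∫ x, ∑ k, ‖fderiv ℝ g' x (EuclideanSpace.single k (1 : ℝ))‖ ^ 2 ∂μ := hP
      _ ≤ (ℓ / Real.pi) ^ 2 * ∫ x, 3 * ‖fderiv ℝ g (x + v)‖ ^ 2 ∂μ := by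
          refine mul_le_mul_of_nonneg_left ?_ (sq_nonneg _)
          rw [hμ]
          exact setIntegral_mono_on (hbdd.integrable_sum_norm_fderiv_sq _ _) hint3
            (measurableSet_box ℓ) hsum
      _ = 3 * (ℓ / Real.pi) ^ 2 * ∫ x in box ℓ, ‖fderiv ℝ g (x + v)‖ ^ 2 := by
          rw [integral_const_mul, hμ]; ring
      _ ≤ ℓ ^ 2 * ∫ x in box ℓ, ‖fderiv ℝ g (x + v)‖ ^ 2 := mul_le_mul_of_nonneg_right hpi hI
  -- back to `ℝ≥0∞` and to the corner `p`
  have hL : ∫⁻ y in {y : E3 | ∀ k, y k ∈ Ioo (p k) (p k + ℓ)}, ENNReal.ofReal ((g y - M) ^ 2) =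
      ENNReal.ofReal (∫ x in box ℓ, (g' x - M) ^ 2) := by
    rw [htrans, ofReal_integral_eq_lintegral_ofReal hint1 (ae_of_all _ fun _ => sq_nonneg _), hμ]
  have hR : ∫⁻ y in {y : E3 | ∀ k, y k ∈ Ioo (p k) (p k + ℓ)},
      ENNReal.ofReal (‖fderiv ℝ g y‖ ^ 2) =
        ENNReal.ofReal (∫ x in box ℓ, ‖fderiv ℝ g (x + v)‖ ^ 2) := by
    rw [htrans, ofReal_integral_eq_lintegral_ofReal hint2 (ae_of_all _ fun _ => sq_nonneg _), hμ]
  rw [hL, hR, ← ENNReal.ofReal_mul (sq_nonneg _)]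
  exact ENNReal.ofReal_le_ofReal hreal

/-! ### Gluing of local constants -/

/-- `(s − t)² ≤ 2 (s − u)² + 2 (u − t)²` in `ℝ≥0∞`. [folklore] -/
theorem ofReal_sub_sq_le (s t u : ℝ) :
    ENNReal.ofReal ((s - t) ^ 2) ≤
      2 * ENNReal.ofReal ((s - u) ^ 2) + 2 * ENNReal.ofReal ((u - t) ^ 2) := by
  have h2 : (2 : ℝ≥0∞) = ENNReal.ofReal 2 := by simp
  calc ENNReal.ofReal ((s - t) ^ 2) ≤ ENNReal.ofReal (2 * (s - u) ^ 2 + 2 * (u - t) ^ 2) :=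
        ENNReal.ofReal_le_ofReal (by nlinarith [sq_nonneg (s - u - (u - t))])
    _ = 2 * ENNReal.ofReal ((s - u) ^ 2) + 2 * ENNReal.ofReal ((u - t) ^ 2) := by
        rw [ENNReal.ofReal_add (by positivity) (by positivity), ENNReal.ofReal_mul zero_le_two,
          ENNReal.ofReal_mul zero_le_two, h2]

/-- **Gluing two local constants.** If `O ⊆ A ∩ B` and `μ B ≤ R μ O`, then for constants
`m, m'`: `∫_B (φ − m)² ≤ (2 + 4R) ∫_B (φ − m')² + 4R ∫_A (φ − m)²` (the difference of the two
constants is read off on the overlap `O`). [folklore] -/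
theorem glue_const {α : Type*} [MeasurableSpace α] {μ : Measure α} {φ : α → ℝ} {A B O : Set α}
    (hOA : O ⊆ A) (hOB : O ⊆ B) (hφ : AEMeasurable φ (μ.restrict O)) {R : ℝ≥0∞}
    (hR : μ B ≤ R * μ O) (m m' : ℝ) :
    ∫⁻ y in B, ENNReal.ofReal ((φ y - m) ^ 2) ∂μ ≤
      (2 + 4 * R) * ∫⁻ y in B, ENNReal.ofReal ((φ y - m') ^ 2) ∂μ +
        4 * R * ∫⁻ y in A, ENNReal.ofReal ((φ y - m) ^ 2) ∂μ := by
  -- compare with `m'` on `B`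
  have h1 : ∫⁻ y in B, ENNReal.ofReal ((φ y - m) ^ 2) ∂μ ≤
      2 * ∫⁻ y in B, ENNReal.ofReal ((φ y - m') ^ 2) ∂μ +
        2 * (ENNReal.ofReal ((m' - m) ^ 2) * μ B) := by
    calc _ ≤ ∫⁻ y in B, (2 * ENNReal.ofReal ((φ y - m') ^ 2) +
          2 * ENNReal.ofReal ((m' - m) ^ 2)) ∂μ := lintegral_mono fun y => ofReal_sub_sq_le _ _ _
      _ = 2 * ∫⁻ y in B, ENNReal.ofReal ((φ y - m') ^ 2) ∂μ +
            2 * (ENNReal.ofReal ((m' - m) ^ 2) * μ B) := by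
          rw [lintegral_add_right _ measurable_const, lintegral_const_mul' _ _ ENNReal.ofNat_ne_top,
            lintegral_const, Measure.restrict_apply_univ, mul_assoc]
  -- the difference of the constants, on the overlap
  have hmeas : AEMeasurable (fun y => 2 * ENNReal.ofReal ((φ y - m) ^ 2)) (μ.restrict O) :=
    ((hφ.sub_const m).pow_const 2).ennreal_ofReal.const_mul _
  have h2 : ENNReal.ofReal ((m' - m) ^ 2) * μ O ≤
      2 * ∫⁻ y in A, ENNReal.ofReal ((φ y - m) ^ 2) ∂μ +
        2 * ∫⁻ y in B, ENNReal.ofReal ((φ y - m') ^ 2) ∂μ := by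
    calc ENNReal.ofReal ((m' - m) ^ 2) * μ O = ∫⁻ _y in O, ENNReal.ofReal ((m' - m) ^ 2) ∂μ := by
          rw [lintegral_const, Measure.restrict_apply_univ]
      _ ≤ ∫⁻ y in O, (2 * ENNReal.ofReal ((φ y - m) ^ 2) +
            2 * ENNReal.ofReal ((φ y - m') ^ 2)) ∂μ := by
          refine lintegral_mono fun y => ?_
          have h := ofReal_sub_sq_le m' m (φ y)
          have e1 : (m' - φ y) ^ 2 = (φ y - m') ^ 2 := by ring
          rw [e1, add_comm] at h
          exact h
      _ = 2 * ∫⁻ y in O, ENNReal.ofReal ((φ y - m) ^ 2) ∂μ +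
            2 * ∫⁻ y in O, ENNReal.ofReal ((φ y - m') ^ 2) ∂μ := by
          rw [lintegral_add_left' hmeas, lintegral_const_mul' _ _ ENNReal.ofNat_ne_top,
            lintegral_const_mul' _ _ ENNReal.ofNat_ne_top]
      _ ≤ _ := by gcongr
  -- assemble
  have h3 : ENNReal.ofReal ((m' - m) ^ 2) * μ B ≤
      R * (2 * ∫⁻ y in A, ENNReal.ofReal ((φ y - m) ^ 2) ∂μ +
        2 * ∫⁻ y in B, ENNReal.ofReal ((φ y - m') ^ 2) ∂μ) := by
    calc ENNReal.ofReal ((m' - m) ^ 2) * μ B ≤ ENNReal.ofReal ((m' - m) ^ 2) * (R * μ O) := by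
          gcongr
      _ = R * (ENNReal.ofReal ((m' - m) ^ 2) * μ O) := by ring
      _ ≤ _ := by gcongr
  calc _ ≤ 2 * ∫⁻ y in B, ENNReal.ofReal ((φ y - m') ^ 2) ∂μ +
        2 * (ENNReal.ofReal ((m' - m) ^ 2) * μ B) := h1
    _ ≤ 2 * ∫⁻ y in B, ENNReal.ofReal ((φ y - m') ^ 2) ∂μ +
        2 * (R * (2 * ∫⁻ y in A, ENNReal.ofReal ((φ y - m) ^ 2) ∂μ +
          2 * ∫⁻ y in B, ENNReal.ofReal ((φ y - m') ^ 2) ∂μ)) := by gcongr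
    _ = _ := by ring

/-! ### The cubes of a hole -/

/-- `|y_k − c_k| ≤ dist y c` in `E3`. [folklore] -/
theorem abs_sub_apply_le_dist (c y : E3) (k : Fin 3) : |y k - c k| ≤ dist y c := by
  rw [dist_eq_norm]
  have := PiLp.norm_apply_le (y - c) k
  simpa using this

/-- From coordinate bounds to a bound on the squared distance: if `|y_k − c_k| ≤ r_k` for all
`k` then `dist(y, c)² ≤ Σ r_k²`. [folklore] -/
theorem dist_sq_le_of_abs_le (c : E3) {y : E3} {r : Fin 3 → ℝ} (h : ∀ k, |y k - c k| ≤ r k) :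
    dist y c ^ 2 ≤ ∑ k, r k ^ 2 := by
  have hn : dist y c ^ 2 = ∑ k, (y k - c k) ^ 2 := by
    rw [dist_eq_norm, EuclideanSpace.norm_eq, Real.sq_sqrt (by positivity)]
    simp
  rw [hn]
  refine Finset.sum_le_sum fun k _ => ?_
  exact sq_le_sq' (abs_le.1 (h k)).1 (abs_le.1 (h k)).2

/-- The outer cube of a hole lies in the doubled ball: `{‖y − c‖_∞ ≤ (23/20)ρ} ⊆ B(c, 2ρ)`
(`3 · (23/20)² < 4`). [folklore] -/
theorem outerCube_subset_ball (c : E3) {ρ : ℝ} (hρ : 0 < ρ) :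
    {y : E3 | ∀ k, |y k - c k| ≤ 23 / 20 * ρ} ⊆ ball c (2 * ρ) := by
  intro y hy
  rw [mem_ball]
  have hsq : dist y c ^ 2 < (2 * ρ) ^ 2 := by
    refine (dist_sq_le_of_abs_le c (r := fun _ => 23 / 20 * ρ) hy).trans_lt ?_
    simp
    nlinarith
  exact (pow_lt_pow_iff_left₀ dist_nonneg (by linarith) two_ne_zero).1 hsq

/-- The closed ball of a hole lies in its inner cube: `B̄(c, ρ) ⊆ {‖y − c‖_∞ < (11/10)ρ}`.
[folklore] -/
theorem closedBall_subset_innerCube (c : E3) {ρ : ℝ} (hρ : 0 < ρ) :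
    closedBall c ρ ⊆ {y : E3 | ∀ k, |y k - c k| < 11 / 10 * ρ} := by
  intro y hy k
  rw [mem_closedBall] at hy
  exact (abs_sub_apply_le_dist c y k).trans_lt (by linarith)

/-- The cubical shell of a hole lies in the annulus `{ρ < |y − c| < 4ρ}`. [folklore] -/
theorem cubeShell_subset_annulus (c : E3) {ρ : ℝ} (hρ : 0 < ρ) :
    {y : E3 | (∀ k, |y k - c k| ≤ 23 / 20 * ρ) ∧ ¬ ∀ k, |y k - c k| < 11 / 10 * ρ} ⊆
      {y : E3 | ρ < dist y c ∧ dist y c < 4 * ρ} := by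
  intro y hy
  refine ⟨?_, ?_⟩
  · by_contra h
    exact hy.2 (closedBall_subset_innerCube c hρ (mem_closedBall.2 (not_lt.1 h)))
  · have := outerCube_subset_ball c hρ hy.1
    rw [mem_ball] at this
    linarith

end Summit.FinalStateConjecture.FinalStateConjecture.Cruxes.AdiabaticMultiKerrILED.Sketch

end
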